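/-
Copyright (c) 2026 the pub-hodgecm-mathlib formalisation cell (harness21).  Prover seat hodgecm-mathlib-K2Liu-p26 (g0): Track B «K2-LIT»,
#184♮ = hLiu418 = stmt-HodgeConjecture-24832; #42S organ S1, (G) organ ROW (ρ-mid), step (M2a-C1): ★ F6c with the EXPLICIT functional `Haar_{X₁} ⊗ δ₀`
at Kudla's block implementer `j̃(p₁, p₂)` (desk K2Liu-p01 (g10) 15:55:39Z «cheaper route»; cut 15:57Z).
-/
import Summits.HodgeConjecture.HodgeConjecture.Theorems.K2LiuLocalSWMiddleCellValues   -- ★ F6c `exists_ne_zero_swSectionLoc_blkLoc_weylDelta_mul_nElem` (+ ★ F6a, block letters)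
import Literature.NumberTheory.Automorphic.SchwartzBruhatL2Dense                        -- ★ `SchwartzBruhat.continuous_coe`, `hasCompactSupport_coe`
import Literature.NumberTheory.Automorphic.TateLocalZetaShells                          -- ★ `secondCountableTopology_localField`
import HarnessLib

/-!
# Crux `HLiu418`, #42S organ S1, (G) organ ROW (ρ-mid), step (M2a-C1): THE MIDDLE-CELL VALUES AT KUDLA'S BLOCK IMPLEMENTER, EXPLICITLY —
# `F_Ψ(blkLoc(w_Δ^{T₁}) · n(t)) = c · ∫_{X₁} (unipOpPi c_t (op(j̃(p₁,p₂)) Ψ))(x₁ ⊔ 0) dx₁`, ONE `c ≠ 0` for all `t`, `Ψ`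

Cell `hodgecm-mathlib`, crux item hLiu418 = `stmt-HodgeConjecture-24832`, route of record `HCCMUnconditional`; squad K2 ∕ K2Liu, road `K2_Liu`, socket #42S (a),
organ S1; LEAD F0P6-plan (g14), desk K2Liu-p01.  THEOREMS ONLY (no `def`, no `instance`, no `notation`, no named-fact hypothesis, no `sorry`); lane
`--supports stmt-HodgeConjecture-24832` (count-neutral helper).

WHY.  ★ F6c `exists_ne_zero_swSectionLoc_blkLoc_weylDelta_mul_nElem` gives `F_Ψ(w₁·n(t)) = c·Λ(op(P)⁻¹ (unipOpPi c_t (op(P) Ψ)))` for EVERY mover-implementer `P` and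
ANY linear `Λ` with the pure-tensor values `(∫ op(p₁)Φ₁)·(op(p₂)Φ₂)(0)` (`hΛ`) — «the consumer plugs in its explicit `Haar ⊗ δ₀`» (★ F6a §4).  This file does the
plugging at `P := j̃(p₁, p₂)` (★ `boxLoc`, a mover-implementer by ★ F6a `map_deltaLagrangian_proj_boxLoc`, `op(j̃(p₁,p₂)) = op(p₁) ⊠ op(p₂)` by ★ `toOp_boxLoc`)
with **`Λ := (Ψ ↦ ∫_{X₁} Ψ(x₁ ⊔ 0) dx₁) ∘ op(j̃(p₁, p₂))`** (the restriction `x₁ ↦ Ψ(x₁ ⊔ 0)` of a Schwartz–Bruhat function along `glue` is continuous with compact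
support, hence integrable; `hΛ` by ★ `boxEquivSB_boxSB` + ★ `boxSB_apply_glue` + `integral_mul_const`), so that `op(P)⁻¹` cancels:
* **`exists_ne_zero_swSectionLoc_blkLoc_weylDelta_mul_nElem_eq_integral`** — `∃ c ≠ 0, ∀ t Ψ, F_Ψ(blkLoc(w_Δ^{T₁})·n(t)) = c·∫_{X₁} (unipOpPi c_t (op(j̃(p₁,p₂)) Ψ))(x₁ ⊔ 0) dμ^{n₁+n₁}`
  (`c_t = cOfFix 𝕋 (π(j̃) ι(n(t)) π(j̃)⁻¹)`; F6c's binders VERBATIM).  Consumer: (M2a-C2) transports it to the tensor datum by ★ (M1) with the witness's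
  implementer `(E′_ε, Γ_ε) :=` the frame transport of `j̃(p₁, p₂)` (★ (H4) takes it BY VALUE), so `op(j̃)(frameOp⁻¹Φ_ε) = frameOp⁻¹(Γ_εΦ_ε)` and the
  integrand is `ψ_v(−½⟨x₁⊔0, c_t(x₁⊔0)⟩)·(𝟙_{κ⁻¹B₁} − 𝟙_{κ⁻¹B₂})(PD(x₁ ⊔ 0))` — the middle profile row's integral before the κ∕(K1) reading ((M2a-L), K2Liu-p01).
References: [Kudla1994] §3 Thm. 3.1; [Rangarao1993] Lemma 3.2 (3.8); [MoeglinVignerasWaldspurger1987] Chap. 2 II.1 Rem. (6), II.6; [WeilBNT1967] Chap. VII §2 Prop. 2.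
HONEST LABEL.  Count-neutral helper; it retires nothing by itself: `HC_CM` is proved only modulo the 7 printed citations (2 remaining named inputs:
hLiu418 = `stmt-HodgeConjecture-24832`, h413 = `stmt-HodgeConjecture-24833`) until rung 0 closes.
-/

set_option autoImplicit false
set_option linter.dupNamespace false -- the mandated namespace repeats `HodgeConjecture.HodgeConjecture`

noncomputable section

open scoped Matrix
open NumberField IsDedekindDomain MeasureTheory MeasureTheory.Measure Matrix
open Literature.RepresentationTheory.HeisenbergGroup Literature.RepresentationTheory.HeisenbergGroup.SymplecticMatrix
open Literature.NumberTheory.Automorphic Literature.NumberTheory.Automorphic.UnitaryGroup Literature.NumberTheory.Weil1964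
open Literature.NumberTheory.GaloisRepresentations Literature.NumberTheory.GaloisRepresentations.IsNonarchimedeanLocalField
open Literature.RepresentationTheory.HarrisKudlaSweet1996
open Literature.NumberTheory.GelbartRogawski1991.UnitaryDualPair
open Literature.NumberTheory.GelbartRogawski1991.UnitaryDualPair.LocalSplitting
open Literature.NumberTheory.GelbartRogawski1991.UnitaryDualPair.LocalSplitting.DoubledBlock
open Summit.HodgeConjecture.HodgeConjecture.Cruxes.HLiu418.K2LiuLocalSWSectionDefs
open Summit.HodgeConjecture.HodgeConjecture.Cruxes.HLiu418.K2LiuLocalSWBigCellWords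

open Summit.HodgeConjecture.HodgeConjecture.Cruxes.HLiu418.K2LiuLocalSWMiddleCellFunctional

open Summit.HodgeConjecture.HodgeConjecture.Cruxes.HLiu418.K2LiuLocalSWMiddleCellValues
open Summit.HodgeConjecture.HodgeConjecture.Cruxes.HLiu418.K2LiuLocalSWMiddleCellFunctional

namespace Summit.HodgeConjecture.HodgeConjecture.Cruxes.HLiu418.K2LiuBlockMiddleCellHaarDelta


variable (L : Type) [Field L] [NumberField L] [IsCMField L] (v : HeightOneSpectrum (𝓞 (maximalRealSubfield L)))
  [MeasurableSpace (v.adicCompletion (maximalRealSubfield L))] [BorelSpace (v.adicCompletion (maximalRealSubfield L))]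
  (μ : Measure (v.adicCompletion (maximalRealSubfield L))) [μ.IsAddHaarMeasure]
  (n₁ n₂ : ℕ) {T₁ : Matrix (Fin n₁) (Fin n₁) (maximalRealSubfield L)} {T₂ : Matrix (Fin n₂) (Fin n₂) (maximalRealSubfield L)}
  (hT₁ : T₁.IsSymm) (hT₂ : T₂.IsSymm) (hT₁d : IsUnit T₁.det) (hT₂d : IsUnit T₂.det)

variable (χ : HeckeCharacter L) (hχ : IsSplittingChar L 1 χ)


omit [IsCMField L] in
/-- the restriction `x₁ ↦ Ψ(x₁ ⊔ 0)` of a Schwartz–Bruhat function along the block gluing is integrable (continuous with compact support).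
[cite: WeilBNT1967, Chap. VII §2, Prop. 2] -/
theorem integrable_coe_glue_zero
    (Ψ : SchwartzBruhat (Fin ((n₁ + n₂) + (n₁ + n₂)) → v.adicCompletion (maximalRealSubfield L))) :
    Integrable (fun x₁ : Fin (n₁ + n₁) → v.adicCompletion (maximalRealSubfield L) =>
      ((Ψ : SchwartzBruhat (Fin ((n₁ + n₂) + (n₁ + n₂)) → v.adicCompletion (maximalRealSubfield L))) :
        (Fin ((n₁ + n₂) + (n₁ + n₂)) → v.adicCompletion (maximalRealSubfield L)) → ℂ)
        (glue (blkIdx n₁ n₂) x₁ (0 : Fin (n₂ + n₂) → v.adicCompletion (maximalRealSubfield L)))) (Measure.pi fun _ => μ) := by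
  haveI : SecondCountableTopology (v.adicCompletion (maximalRealSubfield L)) := secondCountableTopology_localField (v.adicCompletion (maximalRealSubfield L))
  haveI : SigmaCompactSpace (v.adicCompletion (maximalRealSubfield L)) := sigmaCompactSpace_of_isNonarchimedeanLocalField (v.adicCompletion (maximalRealSubfield L))
  haveI : (Measure.pi fun _ : Fin (n₁ + n₁) => μ).IsAddHaarMeasure := Measure.pi.isAddHaarMeasure _
  have hg : Continuous fun x₁ : Fin (n₁ + n₁) → v.adicCompletion (maximalRealSubfield L) =>
      glue (blkIdx n₁ n₂) x₁ (0 : Fin (n₂ + n₂) → v.adicCompletion (maximalRealSubfield L)) := by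
    refine continuous_pi fun k => ?_
    unfold glue
    rcases (blkIdx n₁ n₂).symm k with i | j
    · exact continuous_apply i
    · exact continuous_const
  refine Continuous.integrable_of_hasCompactSupport ((SchwartzBruhat.continuous_coe Ψ).comp hg) ?_
  refine HasCompactSupport.of_support_subset_isCompact
    (((SchwartzBruhat.hasCompactSupport_coe Ψ).isCompact).image (continuous_pi fun i => continuous_apply ((blkIdx n₁ n₂) (Sum.inl i)))) ?_
  intro x₁ hx₁
  refine ⟨glue (blkIdx n₁ n₂) x₁ 0, subset_tsupport _ hx₁, ?_⟩
  funext i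
  show glue (blkIdx n₁ n₂) x₁ 0 ((blkIdx n₁ n₂) (Sum.inl i)) = x₁ i
  exact congrFun (resL_glue (blkIdx n₁ n₂) x₁ (0 : Fin (n₂ + n₂) → v.adicCompletion (maximalRealSubfield L))) i

include hT₁d in
set_option maxHeartbeats 4000000 in -- MEASURED: 1600000 fails (`isDefEq` in the ★ F6c instance); as ★ F6c itself
/-- **(M2a-C1) THE MIDDLE-CELL VALUES AT `j̃(p₁, p₂)` WITH `Λ = (Haar_{X₁} ⊗ δ₀) ∘ op(j̃)`**: with F6c's data (`T₁ = diag t₁`, `0 < n₁`; outer mover-implementer `m₀`;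
block implementers `p₁` Cayley-type (`hW₁`) and `p₂` over movers), there is ONE `c ≠ 0` with, for every skew `t` and every `Ψ`,
`F_Ψ(blkLoc(w_Δ^{T₁}) · n(t)) = c · ∫_{X₁} (unipOpPi c_t (op(j̃(p₁,p₂)) Ψ))(x₁ ⊔ 0) dμ^{⊗(n₁+n₁)}`.
[cite: Kudla1994, §3 Thm. 3.1] [cite: Rangarao1993, Lemma 3.2 (3.8), p. 351] [cite: MoeglinVignerasWaldspurger1987, Chap. 2 II.1 Rem. (6), II.6] -/
theorem exists_ne_zero_swSectionLoc_blkLoc_weylDelta_mul_nElem_eq_integral (hn₁ : 0 < n₁) (t₁ : Fin n₁ → maximalRealSubfield L)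
    (hT₁t : T₁ = Matrix.diagonal t₁)
    (hTv₁ : IsUnit (localGram (maximalRealSubfield L) (n₁ + n₁) (gramD (maximalRealSubfield L) n₁ T₁) v).det)
    (m₀ : LocalMp (maximalRealSubfield L) ((n₁ + n₂) + (n₁ + n₂)) (gramD (maximalRealSubfield L) (n₁ + n₂) (UnitaryGroup.finSum n₁ n₂ T₁ T₂)) v)
    (hm₀ : (deltaLagrangian (maximalRealSubfield L) v (n₁ + n₂)).map (toLin (maximalRealSubfield L) v (MpPsi.proj _ m₀)) =
      lagrangianY (maximalRealSubfield L) ((n₁ + n₂) + (n₁ + n₂)) v)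
    (p₁ : LocalMp (maximalRealSubfield L) (n₁ + n₁) (gramD (maximalRealSubfield L) n₁ T₁) v)
    (hp₁ : (deltaLagrangian (maximalRealSubfield L) v n₁).map (toLin (maximalRealSubfield L) v (MpPsi.proj _ p₁)) = lagrangianY (maximalRealSubfield L) (n₁ + n₁) v)
    (B₁ : GL (Fin (n₁ + n₁)) (v.adicCompletion (maximalRealSubfield L)))
    (hW₁ : MpPsi.proj _ p₁ * iotaD (maximalRealSubfield L) L (IsCMField.complexConj L) (complexConj_imagUnit L) (imagUnit_ne_zero L)
        (imagUnit_mul_self L) v n₁ hT₁ rfl (weylDelta (maximalRealSubfield L) L (IsCMField.complexConj L) v n₁ (T₀ := T₁) rfl) * (MpPsi.proj _ p₁)⁻¹ =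
      (transportSp (localGram (maximalRealSubfield L) (n₁ + n₁) (gramD (maximalRealSubfield L) n₁ T₁) v) hTv₁ (SymplecticGroup.symJ _ _))⁻¹ *
        transportSp (localGram (maximalRealSubfield L) (n₁ + n₁) (gramD (maximalRealSubfield L) n₁ T₁) v) hTv₁ (levi B₁))
    {m : ℤ} (hm : (adeleAddCharAt (maximalRealSubfield L) v).HasConductorExp m)
    (p₂ : LocalMp (maximalRealSubfield L) (n₂ + n₂) (gramD (maximalRealSubfield L) n₂ T₂) v)
    (hp₂ : (deltaLagrangian (maximalRealSubfield L) v n₂).map (toLin (maximalRealSubfield L) v (MpPsi.proj _ p₂)) = lagrangianY (maximalRealSubfield L) (n₂ + n₂) v)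
 :
    ∃ c : ℂ, c ≠ 0 ∧ ∀ (t : Matrix (Fin (n₁ + n₂)) (Fin (n₁ + n₂)) (LocalRing L v))
      (ht : (t.map (conjLocal L (IsCMField.complexConj L) v))ᵀ * gramS (maximalRealSubfield L) L v (n₁ + n₂) (UnitaryGroup.finSum n₁ n₂ T₁ T₂) +
        gramS (maximalRealSubfield L) L v (n₁ + n₂) (UnitaryGroup.finSum n₁ n₂ T₁ T₂) * t = 0)
      (Ψ : SchwartzBruhat (Fin ((n₁ + n₂) + (n₁ + n₂)) → v.adicCompletion (maximalRealSubfield L))),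
      swSectionLoc L v
          (localSplittingDatumCM L v μ (n₁ + n₂) (UnitaryGroup.isSymm_finSum hT₁ hT₂) (isUnit_det_finSum L n₁ n₂ hT₁d hT₂d) rfl χ hχ).localSplitting
          m₀ Ψ
          (blkLoc (maximalRealSubfield L) L (IsCMField.complexConj L) v n₁ n₂ (T₁ := T₁) (T₂ := T₂) rfl rfl
              (weylDelta (maximalRealSubfield L) L (IsCMField.complexConj L) v n₁ (T₀ := T₁) rfl) *
            nElem (maximalRealSubfield L) L (IsCMField.complexConj L) v (n₁ + n₂) (T₀ := UnitaryGroup.finSum n₁ n₂ T₁ T₂) rfl t ht) =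
        c * ∫ x₁ : Fin (n₁ + n₁) → v.adicCompletion (maximalRealSubfield L),
          ((unipOpPi (isLocallyConstant_of_isContinuousNontrivial (isContinuousNontrivial_adeleAddCharAt (maximalRealSubfield L) v))
            (Matrix.mulVecLin (cOfFix (localGram (maximalRealSubfield L) ((n₁ + n₂) + (n₁ + n₂)) (gramD (maximalRealSubfield L) (n₁ + n₂) (UnitaryGroup.finSum n₁ n₂ T₁ T₂)) v)
              (MpPsi.proj _ (boxLoc (maximalRealSubfield L) v n₁ n₂ (T₁ := T₁) (T₂ := T₂) (p₁, p₂)) *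
                iotaD (maximalRealSubfield L) L (IsCMField.complexConj L) (complexConj_imagUnit L) (imagUnit_ne_zero L) (imagUnit_mul_self L) v
                  (n₁ + n₂) (UnitaryGroup.isSymm_finSum hT₁ hT₂) rfl
                  (nElem (maximalRealSubfield L) L (IsCMField.complexConj L) v (n₁ + n₂) (T₀ := UnitaryGroup.finSum n₁ n₂ T₁ T₂) rfl t ht) *
                (MpPsi.proj _ (boxLoc (maximalRealSubfield L) v n₁ n₂ (T₁ := T₁) (T₂ := T₂) (p₁, p₂)))⁻¹)))
            (MpPsi.toOp _ (boxLoc (maximalRealSubfield L) v n₁ n₂ (T₁ := T₁) (T₂ := T₂) (p₁, p₂)) Ψ) :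
              SchwartzBruhat (Fin ((n₁ + n₂) + (n₁ + n₂)) → v.adicCompletion (maximalRealSubfield L))) :
            (Fin ((n₁ + n₂) + (n₁ + n₂)) → v.adicCompletion (maximalRealSubfield L)) → ℂ)
            (glue (blkIdx n₁ n₂) x₁ (0 : Fin (n₂ + n₂) → v.adicCompletion (maximalRealSubfield L))) ∂(Measure.pi fun _ => μ) := by
  -- the explicit functional `Λ₀ = Haar_{X₁} ⊗ δ₀` and `Λ := Λ₀ ∘ op(j̃(p₁,p₂))`
  let Λ₀ : SchwartzBruhat (Fin ((n₁ + n₂) + (n₁ + n₂)) → v.adicCompletion (maximalRealSubfield L)) →ₗ[ℂ] ℂ :=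
    { toFun := fun Ψ => ∫ x₁ : Fin (n₁ + n₁) → v.adicCompletion (maximalRealSubfield L),
        ((Ψ : SchwartzBruhat _) : (Fin ((n₁ + n₂) + (n₁ + n₂)) → v.adicCompletion (maximalRealSubfield L)) → ℂ)
          (glue (blkIdx n₁ n₂) x₁ (0 : Fin (n₂ + n₂) → v.adicCompletion (maximalRealSubfield L))) ∂(Measure.pi fun _ => μ)
      map_add' := fun Ψ Ψ' => by
        simp only [Submodule.coe_add, Pi.add_apply]
        exact integral_add (integrable_coe_glue_zero L v μ n₁ n₂ Ψ) (integrable_coe_glue_zero L v μ n₁ n₂ Ψ')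
      map_smul' := fun a Ψ => by
        simp only [Submodule.coe_smul, Pi.smul_apply, smul_eq_mul, RingHom.id_apply]
        exact integral_const_mul a _ }
  let Λ : SchwartzBruhat (Fin ((n₁ + n₂) + (n₁ + n₂)) → v.adicCompletion (maximalRealSubfield L)) →ₗ[ℂ] ℂ :=
    Λ₀ ∘ₗ (MpPsi.toOp _ (boxLoc (maximalRealSubfield L) v n₁ n₂ (T₁ := T₁) (T₂ := T₂) (p₁, p₂))).toLinearMap
  have hΛapply : ∀ Θ, Λ Θ = Λ₀ (MpPsi.toOp _ (boxLoc (maximalRealSubfield L) v n₁ n₂ (T₁ := T₁) (T₂ := T₂) (p₁, p₂)) Θ) := fun Θ => rfl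
  have hΛ₀apply : ∀ Θ : SchwartzBruhat (Fin ((n₁ + n₂) + (n₁ + n₂)) → v.adicCompletion (maximalRealSubfield L)),
      Λ₀ Θ = ∫ x₁ : Fin (n₁ + n₁) → v.adicCompletion (maximalRealSubfield L),
        ((Θ : SchwartzBruhat _) : (Fin ((n₁ + n₂) + (n₁ + n₂)) → v.adicCompletion (maximalRealSubfield L)) → ℂ)
          (glue (blkIdx n₁ n₂) x₁ (0 : Fin (n₂ + n₂) → v.adicCompletion (maximalRealSubfield L))) ∂(Measure.pi fun _ => μ) := fun Θ => rfl
  have hΛ : ∀ (Φ₁ : SchwartzBruhat (Fin (n₁ + n₁) → v.adicCompletion (maximalRealSubfield L)))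
      (Φ₂ : SchwartzBruhat (Fin (n₂ + n₂) → v.adicCompletion (maximalRealSubfield L))),
      Λ (boxSB (v.adicCompletion (maximalRealSubfield L)) (blkIdx n₁ n₂) Φ₁ Φ₂) =
        (∫ x : Fin (n₁ + n₁) → v.adicCompletion (maximalRealSubfield L),
            ((MpPsi.toOp _ p₁ Φ₁ : SchwartzBruhat (Fin (n₁ + n₁) → v.adicCompletion (maximalRealSubfield L))) :
              (Fin (n₁ + n₁) → v.adicCompletion (maximalRealSubfield L)) → ℂ) x ∂(Measure.pi fun _ => μ)) *
          ((MpPsi.toOp _ p₂ Φ₂ : SchwartzBruhat (Fin (n₂ + n₂) → v.adicCompletion (maximalRealSubfield L))) :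
            (Fin (n₂ + n₂) → v.adicCompletion (maximalRealSubfield L)) → ℂ) 0 := by
    intro Φ₁ Φ₂
    rw [hΛapply, toOp_boxLoc, boxEquivSB_boxSB, hΛ₀apply]
    simp only [boxSB_apply_glue]
    exact integral_mul_const _ _
  obtain ⟨c, hc, h⟩ := exists_ne_zero_swSectionLoc_blkLoc_weylDelta_mul_nElem L v μ n₁ n₂ hT₁ hT₂ hT₁d hT₂d χ hχ hn₁ t₁ hT₁t hTv₁ m₀ hm₀ p₁ hp₁
    B₁ hW₁ hm p₂ hp₂ Λ hΛ
  -- `Λ ∘ op(P)⁻¹ = Λ₀` (a cheap rewrite on a variable `Θ`; `rw` on the assembled goal is a `whnf` time-out — MEASURED)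
  have hΛsymm : ∀ Θ, Λ ((MpPsi.toOp _ (boxLoc (maximalRealSubfield L) v n₁ n₂ (T₁ := T₁) (T₂ := T₂) (p₁, p₂))).symm Θ) = Λ₀ Θ := fun Θ => by
    rw [hΛapply, LinearEquiv.apply_symm_apply]
  refine ⟨c, hc, fun t ht Ψ => ?_⟩
  refine (h (boxLoc (maximalRealSubfield L) v n₁ n₂ (T₁ := T₁) (T₂ := T₂) (p₁, p₂)) (map_deltaLagrangian_proj_boxLoc L v n₁ n₂ p₁ p₂ hp₁ hp₂) t ht Ψ).trans ?_
  exact congrArg (fun z => c * z) ((hΛsymm _).trans (hΛ₀apply _))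

end Summit.HodgeConjecture.HodgeConjecture.Cruxes.HLiu418.K2LiuBlockMiddleCellHaarDelta

end
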